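import Summits.ResolutionOfSingularities.ResolutionOfSingularities.Theorems.EquisingularLiftEquisingularLiftNatSpecimenQuarticDerivations
import Mathlib.RingTheory.MvPolynomial.Ideal
import Mathlib.RingTheory.RegularLocalRing.Polynomial
import Mathlib.Algebra.MvPolynomial.PDeriv
import HarnessLib

/-!
# [OURS · L1 W4.5(b)] T-EBETA-CHARTS, I: exit (E-β) at the VERTEX — ordinary double and triple points

Helper for the research stub `stub_elnat_three_isolated_nonabs` of the crux `EquisingularLiftNatThree`
(stmt-ResolutionOfSingularities-20148, child of `EquisingularLiftNat` stmt-20038; route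
`EquisingularLift`, chain w45b, CHAIN v7.2/7.3 §3 row **T-EBETA-CHARTS** named to stub-4;
res-L1-w45b-lead-2 LEAD-MEMO-2 §5–§6 exit **(E-β)**). NOT a statement of any manuscript; AI-written
kernel lemma of the cell `res-hironaka` (weaker than expert review).

**(E-β)** (lead-2): at a point `q` of multiplicity `m` of the plane curve `Γ = V(ḡ) ⊂ E_k` take the
TRANSVERSAL section and the `O`-model `D = V(G) ⊂ E_O = 𝔸²_O`, `G = g̃ + ϖ^(m+1)·u` («ϖ-adically
trivial to order `m`»). The centre candidate is `C = Bl_q D`, the strict transform of `D` under the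
blow-up of `𝔸²_O` at the closed point `𝔪 = (ϖ, x, y)`. Its projectivised tangent cone is the CONE over
the `m` tangent directions with VERTEX the `ϖ`-direction `[1:0:0]` — not smooth, so the smooth-cone
kernel (E-β′, res-L1-w45b-stub-3) does not apply at the vertex; the `ϖ^(m+1)u` term is what makes
`Bl_q D` regular there («`x = ϖx₁` gives `ḡ_m(x₁,y₁) + … + ϖu`, linear in `ϖ`», LEAD-MEMO-2 §5).

**This file = the vertex chart.** The `ϖ`-chart of `Bl_𝔪 𝔸²_O` is the polynomial ring
`A[𝔪/ϖ] = O[T₁, T₂]` (`x = ϖT₁`, `y = ϖT₂`), the exceptional divisor is `V(ϖ)`, the vertex is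
`(ϖ, T₁, T₂)`, and `G(ϖT₁, ϖT₂) = ϖ^m · g′(T₁, T₂)`. Over a domain `O` in which `(ϖ)` is a maximal
ideal (a DVR and its uniformizer), with `A′ := O[T₁,T₂] = MvPolynomial (Fin 2) O`:

* `isRegularLocalRing_quotient_of_forall_not_mem_sq` — the local half of Stacks 07PF: `f ∈ Q`,
  `u·f ∉ Q²` for all `u ∉ Q` ⟹ `A′_Q/(f)` is a regular local ring (any regular ring);
* **`vertex_test`** — the E-β mechanism: for `h ∈ (T₁, T₂)` (zero constant term), `u ∈ Oˣ` and a
  prime `Q ⊇ (ϖ, T₁, T₂)`: `v·(h + ϖu) ∉ Q²` for every `v ∉ Q` (constant coefficients: those of `Q²`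
  lie in `(ϖ²)`);
* ordinary DOUBLE point, `N = 3`: `G = xy + ϖ³u`, `g′ = T₁T₂ + ϖu` (`node_chart_identity`);
  **`node_regular_along_E`**: at every prime `Q ∋ ϖ, g′` of `A′`, `A′_Q/(g′)` is regular (off the
  vertex by the derivations `∂/∂T₁ ↦ T₂`, `∂/∂T₂ ↦ T₁`; at the vertex by `vertex_test`);
* ordinary TRIPLE point (the Fano-type `¬`H-CONE case), `N = 4`: `G = xy(x+y) + ϖ⁴u`,
  `g′ = T₁T₂(T₁+T₂) + ϖu` (`triple_chart_identity`); **`triple_regular_along_E`** likewise (the case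
  analysis on `∂₁g′ = T₂(2T₁+T₂)`, `∂₂g′ = T₁(T₁+2T₂)` needs no assumption on the residue
  characteristic).

Part II (`…NatEBetaCusp.lean`): the cusp rows `N = 2` ✓ / `N = 3` ✗ of LEAD-MEMO-2 §5. NOT here: the
charts `x`, `y` of `Bl_𝔪` away from the vertex (there the cone is smooth: (E-β′), stub-3), the iso
`A[𝔪/ϖ] ≅ O[T₁,T₂]` in blowup-algebra currency, E1/flatness of `C`, and anything scheme-level.

References: The Stacks Project, Tag 07PF; H. Matsumura, *Commutative Ring Theory*, Thm. 14.2 — through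
the cited tree files (`RegularDerivationQuotient`, `RegularLocalRingsQuotient`).
-/

set_option linter.dupNamespace false -- mandated namespace `Summit.<Summit>.<Problem>` of this single-conjunct summit

noncomputable section

open MvPolynomial IsLocalRing
open Literature.AlgebraicGeometry.Resolution
open Summit.ResolutionOfSingularities.ResolutionOfSingularities.Theorems.EquisingularLift.SpecimenQuartic

namespace Summit.ResolutionOfSingularities.ResolutionOfSingularities.Theorems.EquisingularLift.EBeta

universe u

/-! ## The local half of Stacks 07PF -/

section Local

variable {C : Type u} [CommRing C]

/-- **`f ∉ Q⁽²⁾ ⟹ C_Q/(f)` regular** for a regular ring `C`, a prime `Q ∋ f` and the symbolic-square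
condition `u·f ∉ Q²` for all `u ∉ Q` (then `f ∈ QC_Q ∖ Q²C_Q`; Matsumura 14.2). The local half of the
tree's `isRegularRing_quotient_of_derivation(s)`. [cite: StacksProject, Tag 07PF] -/
theorem isRegularLocalRing_quotient_of_forall_not_mem_sq [IsRegularRing C] (f : C) (Q : Ideal C)
    [Q.IsPrime] (hfQ : f ∈ Q) (h : ∀ u ∉ Q, u * f ∉ Q ^ 2) :
    IsRegularLocalRing (Localization.AtPrime Q ⧸ Ideal.span {algebraMap C (Localization.AtPrime Q) f}) := by
  have hfm : algebraMap C (Localization.AtPrime Q) f ∈ maximalIdeal (Localization.AtPrime Q) := by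
    rw [← Localization.AtPrime.map_eq_maximalIdeal]
    exact Ideal.mem_map_of_mem _ hfQ
  have hfm2 : algebraMap C (Localization.AtPrime Q) f ∉ maximalIdeal (Localization.AtPrime Q) ^ 2 := by
    rw [← Localization.AtPrime.map_eq_maximalIdeal, ← Ideal.map_pow,
      IsLocalization.algebraMap_mem_map_algebraMap_iff Q.primeCompl]
    rintro ⟨u, hu, huf⟩
    exact h u hu huf
  exact (IsRegularLocalRing.quotient_span_singleton hfm hfm2).1

/-- The derivation certificate, local form: `D f ∉ Q` for some derivation `D` gives the
symbolic-square condition at `Q` (`not_mem_sq_of_derivation_not_mem`, part 0 of the T-ISO-1 algebra),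
hence `C_Q/(f)` regular. [cite: StacksProject, Tag 07PF] -/
theorem isRegularLocalRing_quotient_of_derivation [IsRegularRing C] {S₀ : Type*} [CommSemiring S₀]
    [Algebra S₀ C] (f : C) (D : Derivation S₀ C C) (Q : Ideal C) [Q.IsPrime] (hfQ : f ∈ Q)
    (hDf : D f ∉ Q) :
    IsRegularLocalRing (Localization.AtPrime Q ⧸ Ideal.span {algebraMap C (Localization.AtPrime Q) f}) :=
  isRegularLocalRing_quotient_of_forall_not_mem_sq f Q hfQ
    fun _ hu => not_mem_sq_of_derivation_not_mem f D Q hfQ hDf hu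

end Local

/-! ## The vertex test in `A′ = O[T₁, T₂]` -/

section Vertex

variable {O : Type u} [CommRing O]

/-- A polynomial with zero constant term lies in `(T₁, T₂)`, hence in every ideal containing the
variables. [folklore] -/
theorem mem_of_constantCoeff_eq_zero {Q : Ideal (MvPolynomial (Fin 2) O)}
    (hX : ∀ i, (X i : MvPolynomial (Fin 2) O) ∈ Q) {p : MvPolynomial (Fin 2) O}
    (hp : constantCoeff p = 0) : p ∈ Q := by
  have hmem : p ∈ Ideal.span (MvPolynomial.X '' (Set.univ : Set (Fin 2)) : Set (MvPolynomial (Fin 2) O)) := by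
    rw [MvPolynomial.mem_ideal_span_X_image]
    intro m hm
    have hm0 : m ≠ 0 := by
      rintro rfl
      rw [MvPolynomial.mem_support_iff] at hm
      exact hm hp
    obtain ⟨i, hi⟩ := Finsupp.ne_iff.mp hm0
    exact ⟨i, Set.mem_univ i, hi⟩
  refine (Ideal.span_le.mpr ?_) hmem
  rintro _ ⟨i, -, rfl⟩
  exact hX i

/-- Membership in a prime `Q ⊇ (T₁, T₂)` is read on constant coefficients: `p ∈ Q ↔ C(p(0)) ∈ Q`.
[folklore] -/
theorem mem_iff_C_constantCoeff_mem {Q : Ideal (MvPolynomial (Fin 2) O)}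
    (hX : ∀ i, (X i : MvPolynomial (Fin 2) O) ∈ Q) (p : MvPolynomial (Fin 2) O) :
    p ∈ Q ↔ C (constantCoeff p) ∈ Q := by
  have hsub : p - C (constantCoeff p) ∈ Q :=
    mem_of_constantCoeff_eq_zero hX (by simp)
  constructor
  · intro hp
    have := Q.sub_mem hp hsub
    rwa [sub_sub_cancel] at this
  · intro hc
    have := Q.add_mem hsub hc
    rwa [sub_add_cancel] at this

/-- Constant coefficients of `Q²` lie in `Q₀²`, `Q₀ = C⁻¹Q ⊆ O`: for `a, b ∈ Q`, `(ab)(0) = a(0)b(0)`.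
[folklore] -/
theorem constantCoeff_mem_sq_of_mem_sq {Q : Ideal (MvPolynomial (Fin 2) O)}
    (hX : ∀ i, (X i : MvPolynomial (Fin 2) O) ∈ Q) {p : MvPolynomial (Fin 2) O} (hp : p ∈ Q ^ 2) :
    constantCoeff p ∈ (Q.comap (C : O →+* MvPolynomial (Fin 2) O)) ^ 2 := by
  rw [pow_two] at hp ⊢
  refine Submodule.mul_induction_on hp (fun a ha b hb => ?_) (fun a b ha hb => ?_)
  · rw [map_mul]
    refine Ideal.mul_mem_mul ?_ ?_
    · exact Ideal.mem_comap.mpr ((mem_iff_C_constantCoeff_mem hX a).mp ha)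
    · exact Ideal.mem_comap.mpr ((mem_iff_C_constantCoeff_mem hX b).mp hb)
  · rw [map_add]
    exact Ideal.add_mem _ ha hb

/-- **THE VERTEX TEST (the (E-β) mechanism).** `O` a domain, `ϖ ≠ 0` with `(ϖ)` a maximal ideal
(a DVR and its uniformizer), `u` a unit, `h ∈ O[T₁,T₂]` with zero constant term, and `Q` a prime
containing `ϖ, T₁, T₂` (the vertex of the `ϖ`-chart of `Bl_𝔪 𝔸²_O`). Then `h + ϖ·u ∉ Q⁽²⁾`:
`v·(h + ϖu) ∉ Q²` for every `v ∉ Q`. (Constant coefficients: `Q ∩ O = (ϖ)`, those of `Q²` lie in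
`(ϖ²)`, and `v(0)·ϖu ∈ (ϖ²)` forces `v(0) ∈ (ϖ)`, i.e. `v ∈ Q`.) This is «`g′ = ḡ_m(T) + … + ϖu`
is linear in `ϖ` at the vertex» of LEAD-MEMO-2 §5. [OURS · (E-β); folklore commutative algebra] -/
theorem vertex_test [IsDomain O] {ϖ : O} (hϖ : ϖ ≠ 0) (hmax : (Ideal.span {ϖ}).IsMaximal) {u : O}
    (hu : IsUnit u) {h : MvPolynomial (Fin 2) O} (hh : constantCoeff h = 0)
    {Q : Ideal (MvPolynomial (Fin 2) O)} [hQ : Q.IsPrime] (hϖQ : C ϖ ∈ Q)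
    (hX : ∀ i, (X i : MvPolynomial (Fin 2) O) ∈ Q) {v : MvPolynomial (Fin 2) O} (hv : v ∉ Q) :
    v * (h + C (ϖ * u)) ∉ Q ^ 2 := by
  intro hmem
  -- `Q ∩ O = (ϖ)`
  have hQ₀ : Q.comap (C : O →+* MvPolynomial (Fin 2) O) = Ideal.span {ϖ} := by
    refine (hmax.eq_of_le (Ideal.IsPrime.ne_top (Ideal.comap_isPrime C Q)) ?_).symm
    rw [Ideal.span_le, Set.singleton_subset_iff]
    exact hϖQ
  -- constant coefficient of `v (h + ϖu)` is `v(0) ϖ u ∈ (ϖ²)`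
  have hin := constantCoeff_mem_sq_of_mem_sq hX hmem
  rw [map_mul, map_add, hh, zero_add, constantCoeff_C, hQ₀, Ideal.span_singleton_pow,
    Ideal.mem_span_singleton] at hin
  obtain ⟨w, hw⟩ := hin
  -- cancel `ϖ`: `v(0) u = ϖ w`
  have hcancel : constantCoeff v * u = ϖ * w := by
    have h0 : ϖ * (constantCoeff v * u - ϖ * w) = 0 := by linear_combination hw
    rcases mul_eq_zero.mp h0 with h0 | h0
    · exact absurd h0 hϖ
    · exact sub_eq_zero.mp h0
  -- `(ϖ)` is prime, `u ∉ (ϖ)`, so `v(0) ∈ (ϖ)`, i.e. `v ∈ Q`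
  have hvu : constantCoeff v * u ∈ Ideal.span {ϖ} := Ideal.mem_span_singleton.mpr ⟨w, hcancel⟩
  rcases hmax.isPrime.mem_or_mem hvu with h1 | h1
  · apply hv
    rw [mem_iff_C_constantCoeff_mem hX v, ← Ideal.mem_comap, hQ₀]
    exact h1
  · exact hmax.ne_top (Ideal.eq_top_of_isUnit_mem _ h1 hu)

end Vertex

/-! ## Ordinary double point: `G = xy + ϖ³u`, `g′ = T₁T₂ + ϖu` -/

section Node

variable {O : Type u} [CommRing O]

/-- **Chart identity, node.** Substituting `x = ϖT₁`, `y = ϖT₂`: `xy + ϖ³u = ϖ²·(T₁T₂ + ϖu)` — the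
strict transform of the `N = 3` model on the `ϖ`-chart is `g′ = T₁T₂ + ϖu`. [folklore] -/
theorem node_chart_identity (ϖ u : O) :
    aeval ![C ϖ * X 0, C ϖ * X 1] (X 0 * X 1 + C (ϖ ^ 3 * u) : MvPolynomial (Fin 2) O) =
      C ϖ ^ 2 * (X 0 * X 1 + C (ϖ * u)) := by
  simp only [map_add, map_mul, aeval_X, Matrix.cons_val_zero, Matrix.cons_val_one,
    MvPolynomial.algebraMap_eq, aeval_C, map_pow]
  ring

/-- The two partials of `g′ = T₁T₂ + ϖu`. [folklore] -/
theorem pderiv_node (ϖ u : O) :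
    (pderiv 0 : Derivation O (MvPolynomial (Fin 2) O) _) (X 0 * X 1 + C (ϖ * u)) = X 1 ∧
      (pderiv 1 : Derivation O (MvPolynomial (Fin 2) O) _) (X 0 * X 1 + C (ϖ * u)) = X 0 := by
  constructor <;> simp [Derivation.leibniz]

/-- **Node, `ϖ`-chart: `g′ = T₁T₂ + ϖu ∉ Q⁽²⁾` at every prime `Q ∋ ϖ, g′`** (i.e. along the
exceptional divisor): off the vertex one of `∂/∂T₁ ↦ T₂`, `∂/∂T₂ ↦ T₁` is outside `Q`; at the vertex
`(ϖ, T₁, T₂)` the vertex test applies. [OURS · (E-β), LEAD-MEMO-2 §5] -/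
theorem node_not_mem_symbSq [IsDomain O] {ϖ : O} (hϖ : ϖ ≠ 0) (hmax : (Ideal.span {ϖ}).IsMaximal)
    {u : O} (hu : IsUnit u) (Q : Ideal (MvPolynomial (Fin 2) O)) [Q.IsPrime] (hϖQ : C ϖ ∈ Q)
    (hgQ : (X 0 * X 1 + C (ϖ * u) : MvPolynomial (Fin 2) O) ∈ Q)
    {v : MvPolynomial (Fin 2) O} (hv : v ∉ Q) :
    v * (X 0 * X 1 + C (ϖ * u)) ∉ Q ^ 2 := by
  by_cases h1 : (X 1 : MvPolynomial (Fin 2) O) ∈ Q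
  · by_cases h0 : (X 0 : MvPolynomial (Fin 2) O) ∈ Q
    · have hX : ∀ i, (X i : MvPolynomial (Fin 2) O) ∈ Q := fun i => by
        match i with
        | 0 => exact h0
        | 1 => exact h1
      exact vertex_test hϖ hmax hu (h := X 0 * X 1) (by simp) hϖQ hX hv
    · refine not_mem_sq_of_derivation_not_mem _ (pderiv 1) Q hgQ ?_ hv
      rw [(pderiv_node ϖ u).2]
      exact h0
  · refine not_mem_sq_of_derivation_not_mem _ (pderiv 0) Q hgQ ?_ hv
    rw [(pderiv_node ϖ u).1]
    exact h1

/-- **Node, `ϖ`-chart: `Bl_q D` is regular along the exceptional divisor** — at every prime `Q ∋ ϖ, g′`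
of `A′ = O[T₁,T₂]` the local ring `A′_Q/(g′)` is regular (`O` regular, e.g. a DVR).
[OURS · (E-β), LEAD-MEMO-2 §5 «Bl_q{ḡ + ϖ^(m+1)u} is regular», m = 2] -/
theorem node_regular_along_E [IsDomain O] [IsRegularRing O] {ϖ : O} (hϖ : ϖ ≠ 0)
    (hmax : (Ideal.span {ϖ}).IsMaximal) {u : O} (hu : IsUnit u) (Q : Ideal (MvPolynomial (Fin 2) O))
    [Q.IsPrime] (hϖQ : C ϖ ∈ Q) (hgQ : (X 0 * X 1 + C (ϖ * u) : MvPolynomial (Fin 2) O) ∈ Q) :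
    IsRegularLocalRing (Localization.AtPrime Q ⧸
      Ideal.span {algebraMap (MvPolynomial (Fin 2) O) (Localization.AtPrime Q) (X 0 * X 1 + C (ϖ * u))}) :=
  isRegularLocalRing_quotient_of_forall_not_mem_sq _ Q hgQ
    fun _ hv => node_not_mem_symbSq hϖ hmax hu Q hϖQ hgQ hv

end Node

/-! ## Ordinary triple point: `G = xy(x+y) + ϖ⁴u`, `g′ = T₁T₂(T₁+T₂) + ϖu` -/

section Triple

variable {O : Type u} [CommRing O]

/-- **Chart identity, ordinary triple point** (three distinct concurrent lines, the Fano-type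
`¬`H-CONE configuration of LEAD-MEMO-2): `xy(x+y) + ϖ⁴u = ϖ³·(T₁T₂(T₁+T₂) + ϖu)` under `x = ϖT₁`,
`y = ϖT₂`. [folklore] -/
theorem triple_chart_identity (ϖ u : O) :
    aeval ![C ϖ * X 0, C ϖ * X 1] (X 0 * X 1 * (X 0 + X 1) + C (ϖ ^ 4 * u) : MvPolynomial (Fin 2) O) =
      C ϖ ^ 3 * (X 0 * X 1 * (X 0 + X 1) + C (ϖ * u)) := by
  simp only [map_add, map_mul, aeval_X, Matrix.cons_val_zero, Matrix.cons_val_one,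
    MvPolynomial.algebraMap_eq, aeval_C, map_pow]
  ring

/-- The two partials of `g′ = T₁T₂(T₁+T₂) + ϖu`: `∂₁g′ = T₂(2T₁ + T₂)`, `∂₂g′ = T₁(T₁ + 2T₂)`. [folklore] -/
theorem pderiv_triple (ϖ u : O) :
    (pderiv 0 : Derivation O (MvPolynomial (Fin 2) O) _) (X 0 * X 1 * (X 0 + X 1) + C (ϖ * u)) =
        X 1 * (2 * X 0 + X 1) ∧
      (pderiv 1 : Derivation O (MvPolynomial (Fin 2) O) _) (X 0 * X 1 * (X 0 + X 1) + C (ϖ * u)) =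
        X 0 * (X 0 + 2 * X 1) := by
  constructor
  · simp [Derivation.leibniz]
    ring
  · simp [Derivation.leibniz]
    ring

/-- **Triple point, `ϖ`-chart: `g′ = T₁T₂(T₁+T₂) + ϖu ∉ Q⁽²⁾` at every prime `Q ∋ ϖ, g′`.** If both
partials lie in `Q` then (case analysis on the prime `Q`, no assumption on the residue characteristic)
`T₁, T₂ ∈ Q`, i.e. `Q` is the vertex, where the vertex test applies; otherwise a derivation certifies.
[OURS · (E-β), LEAD-MEMO-2 §5–§6 (ordinary m-fold points, m = 3)] -/
theorem triple_not_mem_symbSq [IsDomain O] {ϖ : O} (hϖ : ϖ ≠ 0) (hmax : (Ideal.span {ϖ}).IsMaximal)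
    {u : O} (hu : IsUnit u) (Q : Ideal (MvPolynomial (Fin 2) O)) [hQ : Q.IsPrime] (hϖQ : C ϖ ∈ Q)
    (hgQ : (X 0 * X 1 * (X 0 + X 1) + C (ϖ * u) : MvPolynomial (Fin 2) O) ∈ Q)
    {v : MvPolynomial (Fin 2) O} (hv : v ∉ Q) :
    v * (X 0 * X 1 * (X 0 + X 1) + C (ϖ * u)) ∉ Q ^ 2 := by
  by_cases hd0 : (X 1 * (2 * X 0 + X 1) : MvPolynomial (Fin 2) O) ∈ Q
  swap
  · refine not_mem_sq_of_derivation_not_mem _ (pderiv 0) Q hgQ ?_ hv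
    rw [(pderiv_triple ϖ u).1]
    exact hd0
  by_cases hd1 : (X 0 * (X 0 + 2 * X 1) : MvPolynomial (Fin 2) O) ∈ Q
  swap
  · refine not_mem_sq_of_derivation_not_mem _ (pderiv 1) Q hgQ ?_ hv
    rw [(pderiv_triple ϖ u).2]
    exact hd1
  -- both partials in `Q`: then `Q` is the vertex
  have hprod : (X 0 * X 1 * (X 0 + X 1) : MvPolynomial (Fin 2) O) ∈ Q := by
    have hc : (C (ϖ * u) : MvPolynomial (Fin 2) O) ∈ Q := by
      rw [map_mul]; exact Q.mul_mem_right _ hϖQ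
    have := Q.sub_mem hgQ hc
    rwa [add_sub_cancel_right] at this
  have hX : ∀ i, (X i : MvPolynomial (Fin 2) O) ∈ Q := by
    have key : (X 0 : MvPolynomial (Fin 2) O) ∈ Q ∧ (X 1 : MvPolynomial (Fin 2) O) ∈ Q := by
      rcases hQ.mem_or_mem hd0 with h1 | h1'
      · -- `T₂ ∈ Q`
        rcases hQ.mem_or_mem hd1 with h0 | h0'
        · exact ⟨h0, h1⟩
        · refine ⟨?_, h1⟩
          have := Q.sub_mem h0' (Q.mul_mem_left 2 h1)
          rwa [add_sub_cancel_right] at this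
      · -- `T₂ ∉ Q` would follow otherwise; here `2T₁ + T₂ ∈ Q`
        by_cases h1 : (X 1 : MvPolynomial (Fin 2) O) ∈ Q
        · rcases hQ.mem_or_mem hd1 with h0 | h0'
          · exact ⟨h0, h1⟩
          · refine ⟨?_, h1⟩
            have := Q.sub_mem h0' (Q.mul_mem_left 2 h1)
            rwa [add_sub_cancel_right] at this
        · exfalso
          have h0 : (X 0 : MvPolynomial (Fin 2) O) ∉ Q := fun h0 => by
            apply h1
            have := Q.sub_mem h1' (Q.mul_mem_left 2 h0)
            rwa [add_sub_cancel_left] at this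
          have h0' : (X 0 + 2 * X 1 : MvPolynomial (Fin 2) O) ∈ Q :=
            (hQ.mem_or_mem hd1).resolve_left h0
          have h01 : (X 0 + X 1 : MvPolynomial (Fin 2) O) ∈ Q :=
            ((hQ.mem_or_mem hprod).resolve_left fun h => (hQ.mem_or_mem h).elim h0 h1)
          apply h1
          have := Q.sub_mem h0' h01
          have e : (X 0 + 2 * X 1 - (X 0 + X 1) : MvPolynomial (Fin 2) O) = X 1 := by ring
          rwa [e] at this
    intro i
    match i with
    | 0 => exact key.1
    | 1 => exact key.2
  exact vertex_test hϖ hmax hu (h := X 0 * X 1 * (X 0 + X 1)) (by simp) hϖQ hX hv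

/-- **Triple point, `ϖ`-chart: `Bl_q D` is regular along the exceptional divisor** (`O` regular, e.g.
a DVR): at every prime `Q ∋ ϖ, g′` of `O[T₁,T₂]` the local ring `A′_Q/(g′)` is regular — the
Fano-type `¬`H-CONE triple point is resolved by ONE transversal section + the order-4-trivial model.
[OURS · (E-β), LEAD-MEMO-2 §5] -/
theorem triple_regular_along_E [IsDomain O] [IsRegularRing O] {ϖ : O} (hϖ : ϖ ≠ 0)
    (hmax : (Ideal.span {ϖ}).IsMaximal) {u : O} (hu : IsUnit u) (Q : Ideal (MvPolynomial (Fin 2) O))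
    [Q.IsPrime] (hϖQ : C ϖ ∈ Q)
    (hgQ : (X 0 * X 1 * (X 0 + X 1) + C (ϖ * u) : MvPolynomial (Fin 2) O) ∈ Q) :
    IsRegularLocalRing (Localization.AtPrime Q ⧸
      Ideal.span {algebraMap (MvPolynomial (Fin 2) O) (Localization.AtPrime Q)
        (X 0 * X 1 * (X 0 + X 1) + C (ϖ * u))}) :=
  isRegularLocalRing_quotient_of_forall_not_mem_sq _ Q hgQ
    fun _ hv => triple_not_mem_symbSq hϖ hmax hu Q hϖQ hgQ hv

end Triple



end Summit.ResolutionOfSingularities.ResolutionOfSingularities.Theorems.EquisingularLift.EBeta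

end
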